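import Summits.NavierStokesRegularity.NavierStokesRegularity.Theorems.ExtremiserTransienceNearExtremalTransienceDSSDichotomy
import HarnessLib

/-!
# Route `ExtremiserTransience`, crux `NearExtremalTransience` (stmt-NavierStokesRegularity-21883):
# DSS STRATUM — a DSS flow that is not log-mean sub-extremal is an orbit of exact maximisers (a.e. in time)

`--supports stmt-NavierStokesRegularity-21883` (route-independent). Author: prover seat `ns-et-p1` (g2), on `…DSSDichotomy`.

* `dss_nullset_transport` — along a flow DSS about `T` (factor `c > 1`) with minimal coefficient `k₀ ≥ 0`, a null
  sub-level set `{k₀ < κ⋆} ∩ (a, b]` (`0 ≤ a ≤ b < T`) transports to the next period: `{k₀ < κ⋆} ∩ (φa, φb]` is null,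
  `φτ = T − (T−τ)/c²` (log-periodicity `minimalCoeff_logPeriodic_of_dss` and Lebesgue measure under the affine map
  `τ ↦ T − c²(T−τ)`).
* `dss_perFlow_dichotomy_ray` — **the per-flow dichotomy on the whole ray**: for a classical Leray–Hopf
  rapidly-decaying-datum flow DSS about `T` and a measurable minimal coefficient `k₀ : ℝ → [0,1]` on `[0,T)`, for every
  `t₁ ∈ [0,T)`: EITHER `{τ ∈ (t₁, T) | k₀ τ < κ⋆}` is Lebesgue-null — with `minimalCoeff_le_sharp`: `k₀ = κ⋆` for a.e.
  `τ ∈ (t₁,T)`, i.e. almost every slice `u(τ)` up to the singular time is an EXACT maximiser of the sharp depletion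
  inequality — OR the flow is log-mean sub-extremal with its own `θ < 1`
  (`∫_{t₁}^t k₀²/(T−τ) ≤ (θκ⋆)² log((T−t₁)/(T−t)) + I₀` on `[t₁,T)`).

WHAT THIS IS NOT: no DSS blow-up is constructed or excluded; whether `κ⋆` is attained is open; the crux, its BC5 rung,
the route and the summit stay open; Navier–Stokes regularity is NOT proved. [folklore]
-/

noncomputable section

open Set Filter Topology MeasureTheory
open scoped InnerProductSpace RealInnerProductSpace ENNReal NNReal ContDiff
open Literature.Analysis.FluidPDE

namespace Summit.NavierStokesRegularity.NavierStokesRegularity.Theorems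

-- the problem directory repeats the summit name (`NavierStokesRegularity/NavierStokesRegularity`)
set_option linter.dupNamespace false

namespace DepletionLadder

/-- **Transport of null sub-level sets along a DSS flow.** For a flow DSS about `T` with factor `c > 1`, a coefficient
`k₀ ≥ 0` minimal on `[0,T)` (clause and minimality there), and `0 ≤ a ≤ b < T`: if `{τ | k₀ τ < κ⋆} ∩ (a,b]` is null
then so is `{τ | k₀ τ < κ⋆} ∩ (T − (T−a)/c², T − (T−b)/c²]` (the latter is contained in the preimage of the former
under the affine map `τ ↦ T − c²(T−τ)`, by log-periodicity of `k₀`; Lebesgue measure scales by `c⁻²` under it).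
[folklore] -/
theorem dss_nullset_transport {c T : ℝ} (hc : 1 < c)
    {u : ℝ → EuclideanSpace ℝ (Fin 3) → EuclideanSpace ℝ (Fin 3)}
    (hdss : IsDiscretelySelfSimilar c (fun s x => u (T + s) x))
    {k₀ : ℝ → ℝ} (hk₀0 : ∀ τ, 0 ≤ k₀ τ)
    (hcl : (∀ t ∈ Ico 0 T, ∀ M : ℝ, (∀ x, ‖u t x‖ ≤ M) →
      |∫ x, ⟪curl (u t) x, fderiv ℝ (u t) x (curl (u t) x)⟫_ℝ| ≤
        k₀ t * M * Real.sqrt (∫ x, ‖curl (u t) x‖ ^ 2) *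
          Real.sqrt (∫ x, frobeniusNormSq (fderiv ℝ (curl (u t)) x))))
    (hmin : (∀ t ∈ Ico 0 T, ∀ c : ℝ, 0 ≤ c →
      (∀ M : ℝ, (∀ x, ‖u t x‖ ≤ M) →
        |∫ x, ⟪curl (u t) x, fderiv ℝ (u t) x (curl (u t) x)⟫_ℝ| ≤
          c * M * Real.sqrt (∫ x, ‖curl (u t) x‖ ^ 2) *
            Real.sqrt (∫ x, frobeniusNormSq (fderiv ℝ (curl (u t)) x))) → k₀ t ≤ c))
    {a b : ℝ} (ha : 0 ≤ a) (hab : a ≤ b) (hb : b < T)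
    (h0 : volume ({τ | k₀ τ < sInf {κ : ℝ | (∀ (v : EuclideanSpace ℝ (Fin 3) → EuclideanSpace ℝ (Fin 3)) (M B : ℝ), ContDiff ℝ (⊤ : ℕ∞) v → Literature.Analysis.FluidPDE.VectorCalculus.IsDivFree v → (∀ x, ‖v x‖ ≤ M) → (∀ x, ‖fderiv ℝ v x‖ ≤ B) → (∫⁻ x, ‖iteratedFDeriv ℝ 0 v x‖ₑ ^ 2 < ⊤) → (∫⁻ x, ‖iteratedFDeriv ℝ 1 v x‖ₑ ^ 2 < ⊤) → (∫⁻ x, ‖iteratedFDeriv ℝ 2 v x‖ₑ ^ 2 < ⊤) → |∫ x, ⟪Literature.Analysis.FluidPDE.curl v x, fderiv ℝ v x (Literature.Analysis.FluidPDE.curl v x)⟫_ℝ| ≤ κ * M * Real.sqrt (∫ x, ‖Literature.Analysis.FluidPDE.curl v x‖ ^ 2) * Real.sqrt (∫ x, Literature.Analysis.FluidPDE.frobeniusNormSq (fderiv ℝ (Literature.Analysis.FluidPDE.curl v) x)))}} ∩ Ioc a b) = 0) :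
    volume ({τ | k₀ τ < sInf {κ : ℝ | (∀ (v : EuclideanSpace ℝ (Fin 3) → EuclideanSpace ℝ (Fin 3)) (M B : ℝ), ContDiff ℝ (⊤ : ℕ∞) v → Literature.Analysis.FluidPDE.VectorCalculus.IsDivFree v → (∀ x, ‖v x‖ ≤ M) → (∀ x, ‖fderiv ℝ v x‖ ≤ B) → (∫⁻ x, ‖iteratedFDeriv ℝ 0 v x‖ₑ ^ 2 < ⊤) → (∫⁻ x, ‖iteratedFDeriv ℝ 1 v x‖ₑ ^ 2 < ⊤) → (∫⁻ x, ‖iteratedFDeriv ℝ 2 v x‖ₑ ^ 2 < ⊤) → |∫ x, ⟪Literature.Analysis.FluidPDE.curl v x, fderiv ℝ v x (Literature.Analysis.FluidPDE.curl v x)⟫_ℝ| ≤ κ * M * Real.sqrt (∫ x, ‖Literature.Analysis.FluidPDE.curl v x‖ ^ 2) * Real.sqrt (∫ x, Literature.Analysis.FluidPDE.frobeniusNormSq (fderiv ℝ (Literature.Analysis.FluidPDE.curl v) x)))}} ∩ Ioc (T - (T - a) / c ^ 2) (T - (T - b) / c ^ 2)) = 0 := by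
  have hc0 : 0 < c := lt_trans one_pos hc
  have hc2 : 0 < c ^ 2 := pow_pos hc0 2
  have hc1 : 1 ≤ c ^ 2 := by nlinarith
  -- the expanding affine map `ψ τ = c²·τ + (T − c²T) = T − c²(T−τ)`
  set d : ℝ := T - c ^ 2 * T with hd
  have hsub : {τ | k₀ τ < sInf {κ : ℝ | (∀ (v : EuclideanSpace ℝ (Fin 3) → EuclideanSpace ℝ (Fin 3)) (M B : ℝ), ContDiff ℝ (⊤ : ℕ∞) v → Literature.Analysis.FluidPDE.VectorCalculus.IsDivFree v → (∀ x, ‖v x‖ ≤ M) → (∀ x, ‖fderiv ℝ v x‖ ≤ B) → (∫⁻ x, ‖iteratedFDeriv ℝ 0 v x‖ₑ ^ 2 < ⊤) → (∫⁻ x, ‖iteratedFDeriv ℝ 1 v x‖ₑ ^ 2 < ⊤) → (∫⁻ x, ‖iteratedFDeriv ℝ 2 v x‖ₑ ^ 2 < ⊤) → |∫ x, ⟪Literature.Analysis.FluidPDE.curl v x, fderiv ℝ v x (Literature.Analysis.FluidPDE.curl v x)⟫_ℝ| ≤ κ * M * Real.sqrt (∫ x, ‖Literature.Analysis.FluidPDE.curl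 v x‖ ^ 2) * Real.sqrt (∫ x, Literature.Analysis.FluidPDE.frobeniusNormSq (fderiv ℝ (Literature.Analysis.FluidPDE.curl v) x)))}} ∩ Ioc (T - (T - a) / c ^ 2) (T - (T - b) / c ^ 2) ⊆
      (fun τ => c ^ 2 * τ) ⁻¹' ((fun y => y + d) ⁻¹' ({τ | k₀ τ < sInf {κ : ℝ | (∀ (v : EuclideanSpace ℝ (Fin 3) → EuclideanSpace ℝ (Fin 3)) (M B : ℝ), ContDiff ℝ (⊤ : ℕ∞) v → Literature.Analysis.FluidPDE.VectorCalculus.IsDivFree v → (∀ x, ‖v x‖ ≤ M) → (∀ x, ‖fderiv ℝ v x‖ ≤ B) → (∫⁻ x, ‖iteratedFDeriv ℝ 0 v x‖ₑ ^ 2 < ⊤) → (∫⁻ x, ‖iteratedFDeriv ℝ 1 v x‖ₑ ^ 2 < ⊤) → (∫⁻ x, ‖iteratedFDeriv ℝ 2 v x‖ₑ ^ 2 < ⊤) → |∫ x, ⟪Literature.Analysis.FluidPDE.curl v x, fderiv ℝ v x (Literature.Analysis.FluidPDE.curl v x)⟫_ℝ| ≤ κ * M * Real.sqrt (∫ x,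 ‖Literature.Analysis.FluidPDE.curl v x‖ ^ 2) * Real.sqrt (∫ x, Literature.Analysis.FluidPDE.frobeniusNormSq (fderiv ℝ (Literature.Analysis.FluidPDE.curl v) x)))}} ∩ Ioc a b)) := by
    rintro τ ⟨hk, hτ1, hτ2⟩
    simp only [mem_preimage, mem_inter_iff, mem_setOf_eq, mem_Ioc]
    have hψ : c ^ 2 * τ + d = T - c ^ 2 * (T - τ) := by rw [hd]; ring
    rw [hψ]
    -- `τ = T − σ` with `σ = T − τ`; log-periodicity gives `k₀ (T − c²σ) = k₀ (T − σ)`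
    have hτT : τ < T := by
      have : 0 < (T - b) / c ^ 2 := div_pos (sub_pos.2 hb) hc2
      linarith
    have hσ0 : 0 < T - τ := sub_pos.2 hτT
    have hτ0 : 0 ≤ τ := by
      have h1 : (T - a) / c ^ 2 ≤ T - a := div_le_self (sub_nonneg.2 (hab.trans hb.le)) hc1
      linarith
    have hσT : T - τ ≤ T := by linarith
    have hσc : c ^ 2 * (T - τ) ≤ T := by
      have h1 : T - τ < (T - a) / c ^ 2 := by linarith
      have h2 : c ^ 2 * (T - τ) < T - a := by
        have := mul_lt_mul_of_pos_left h1 hc2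
        rwa [mul_div_cancel₀ _ hc2.ne'] at this
      linarith
    have hper := minimalCoeff_logPeriodic_of_dss hc0 hdss hk₀0 hcl hmin hσ0 hσT hσc
    rw [show T - (T - τ) = τ by ring] at hper
    refine ⟨by rw [← hper]; exact hk, ?_, ?_⟩
    · -- `a < T − c²(T−τ)`
      have h1 : T - τ < (T - a) / c ^ 2 := by linarith
      have h2 : c ^ 2 * (T - τ) < T - a := by
        have := mul_lt_mul_of_pos_left h1 hc2
        rwa [mul_div_cancel₀ _ hc2.ne'] at this
      linarith
    · -- `T − c²(T−τ) ≤ b`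
      have h1 : (T - b) / c ^ 2 ≤ T - τ := by linarith
      have h2 : T - b ≤ c ^ 2 * (T - τ) := by
        have := mul_le_mul_of_nonneg_left h1 hc2.le
        rwa [mul_div_cancel₀ _ hc2.ne'] at this
      linarith
  refine measure_mono_null hsub ?_
  rw [Real.volume_preimage_mul_left hc2.ne', measure_preimage_add_right, h0, mul_zero]

/-- **PER-FLOW DICHOTOMY ON THE WHOLE RAY.** Let `u` be a classical Leray–Hopf rapidly-decaying-datum flow on `[0,T)`
(`ν, T > 0`), discretely self-similar about `T` with factor `c > 1`; `k₀ : ℝ → [0,1]` measurable, satisfying the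
flow-wise clause on `[0,T)` and minimal there; `t₁ ∈ [0,T)`, `I₀` the period mass. Then either `{τ | k₀ τ < κ⋆}` is null
in `(t₁, T)` — so `k₀ = κ⋆` a.e. on `(t₁,T)` (`minimalCoeff_le_sharp`): almost every slice up to the singular time is an
exact maximiser of the sharp depletion inequality — or there is `θ ∈ [0,1)` with
`∫_{t₁}^t k₀²/(T−τ) ≤ (θκ⋆)²·log((T−t₁)/(T−t)) + I₀` for all `t ∈ [t₁,T)`. (First period: `dss_perFlow_dichotomy`;
the null set propagates period by period, `dss_nullset_transport`, and the periods `(s n, s (n+1)]`,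
`s n = T − (T−t₁)c^{−2n}`, exhaust `(t₁,T)`.) [folklore] -/
theorem dss_perFlow_dichotomy_ray
    {c ν T t₁ : ℝ} (hc : 1 < c) (hν : 0 < ν) (hT : 0 < T) (ht₁ : t₁ ∈ Ico 0 T)
    {u : ℝ → EuclideanSpace ℝ (Fin 3) → EuclideanSpace ℝ (Fin 3)} {p : ℝ → EuclideanSpace ℝ (Fin 3) → ℝ}
    (hsol : IsClassicalNSSolutionOn (Ico 0 T) ν 0 u p) (hLH : IsLerayHopfOn T ν 0 (u 0) u)
    (hdec : HasRapidSpatialDecay (u 0))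
    (hdss : IsDiscretelySelfSimilar c (fun s x => u (T + s) x))
    {k₀ : ℝ → ℝ} (hk₀m : Measurable k₀) (hk₀01 : ∀ τ, 0 ≤ k₀ τ ∧ k₀ τ ≤ 1)
    (hcl : (∀ t ∈ Ico 0 T, ∀ M : ℝ, (∀ x, ‖u t x‖ ≤ M) →
      |∫ x, ⟪curl (u t) x, fderiv ℝ (u t) x (curl (u t) x)⟫_ℝ| ≤
        k₀ t * M * Real.sqrt (∫ x, ‖curl (u t) x‖ ^ 2) *
          Real.sqrt (∫ x, frobeniusNormSq (fderiv ℝ (curl (u t)) x))))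
    (hmin : (∀ t ∈ Ico 0 T, ∀ c : ℝ, 0 ≤ c →
      (∀ M : ℝ, (∀ x, ‖u t x‖ ≤ M) →
        |∫ x, ⟪curl (u t) x, fderiv ℝ (u t) x (curl (u t) x)⟫_ℝ| ≤
          c * M * Real.sqrt (∫ x, ‖curl (u t) x‖ ^ 2) *
            Real.sqrt (∫ x, frobeniusNormSq (fderiv ℝ (curl (u t)) x))) → k₀ t ≤ c)) :
    volume ({τ | k₀ τ < sInf {κ : ℝ | (∀ (v : EuclideanSpace ℝ (Fin 3) → EuclideanSpace ℝ (Fin 3)) (M B : ℝ), ContDiff ℝ (⊤ : ℕ∞) v → Literature.Analysis.FluidPDE.VectorCalculus.IsDivFree v → (∀ x, ‖v x‖ ≤ M) → (∀ x, ‖fderiv ℝ v x‖ ≤ B) → (∫⁻ x, ‖iteratedFDeriv ℝ 0 v x‖ₑ ^ 2 < ⊤) → (∫⁻ x, ‖iteratedFDeriv ℝ 1 v x‖ₑ ^ 2 < ⊤) → (∫⁻ x, ‖iteratedFDeriv ℝ 2 v x‖ₑ ^ 2 < ⊤) → |∫ x, ⟪Literature.Analysis.FluidPDE.curl v x, fderiv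 ℝ v x (Literature.Analysis.FluidPDE.curl v x)⟫_ℝ| ≤ κ * M * Real.sqrt (∫ x, ‖Literature.Analysis.FluidPDE.curl v x‖ ^ 2) * Real.sqrt (∫ x, Literature.Analysis.FluidPDE.frobeniusNormSq (fderiv ℝ (Literature.Analysis.FluidPDE.curl v) x)))}} ∩ Ioo t₁ T) = 0 ∨
    ∃ θ : ℝ, 0 ≤ θ ∧ θ < 1 ∧ ∀ t ∈ Ico t₁ T, ∫ τ in t₁..t, k₀ τ ^ 2 / (T - τ) ≤
      (θ * sInf {κ : ℝ | (∀ (v : EuclideanSpace ℝ (Fin 3) → EuclideanSpace ℝ (Fin 3)) (M B : ℝ), ContDiff ℝ (⊤ : ℕ∞) v → Literature.Analysis.FluidPDE.VectorCalculus.IsDivFree v → (∀ x, ‖v x‖ ≤ M) → (∀ x, ‖fderiv ℝ v x‖ ≤ B) → (∫⁻ x, ‖iteratedFDeriv ℝ 0 v x‖ₑ ^ 2 < ⊤) → (∫⁻ x, ‖iteratedFDeriv ℝ 1 v x‖ₑ ^ 2 < ⊤) → (∫⁻ x, ‖iteratedFDeriv ℝ 2 v x‖ₑ ^ 2 < ⊤)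 → |∫ x, ⟪Literature.Analysis.FluidPDE.curl v x, fderiv ℝ v x (Literature.Analysis.FluidPDE.curl v x)⟫_ℝ| ≤ κ * M * Real.sqrt (∫ x, ‖Literature.Analysis.FluidPDE.curl v x‖ ^ 2) * Real.sqrt (∫ x, Literature.Analysis.FluidPDE.frobeniusNormSq (fderiv ℝ (Literature.Analysis.FluidPDE.curl v) x)))}) ^ 2 * Real.log ((T - t₁) / (T - t)) +
        ∫ τ in t₁..(T - (T - t₁) / c ^ 2), k₀ τ ^ 2 / (T - τ) := by
  rcases dss_perFlow_dichotomy hc hν hT ht₁ hsol hLH hdec hdss hk₀m hk₀01 hcl hmin with h0 | hθ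
  · left
    have hc0 : 0 < c := lt_trans one_pos hc
    have hc2 : 0 < c ^ 2 := pow_pos hc0 2
    have hc21 : 1 < c ^ 2 := by nlinarith
    have hTt₁ : 0 < T - t₁ := sub_pos.2 ht₁.2
    -- periods `(s n, s (n+1)]`, `s n = T − (T − t₁)(c²)^{-n}`
    obtain ⟨s, hs⟩ : ∃ s : ℕ → ℝ, ∀ n, s n = T - (T - t₁) / (c ^ 2) ^ n := ⟨_, fun _ => rfl⟩
    have hs0 : s 0 = t₁ := by rw [hs]; simp
    have hsT : ∀ n, s n < T := fun n => by
      have : 0 < (T - t₁) / (c ^ 2) ^ n := div_pos hTt₁ (pow_pos hc2 n)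
      rw [hs]; linarith
    have hs0' : ∀ n, 0 ≤ s n := fun n => by
      have h1 : (T - t₁) / (c ^ 2) ^ n ≤ T - t₁ := div_le_self hTt₁.le (one_le_pow₀ hc21.le)
      rw [hs]; linarith [ht₁.1]
    have hsucc : ∀ n, s (n + 1) = T - (T - s n) / c ^ 2 := fun n => by
      rw [hs, hs, pow_succ]
      field_simp
      ring
    have hmono : ∀ n, s n ≤ s (n + 1) := fun n => by
      rw [hsucc]
      have h1 : (T - s n) / c ^ 2 ≤ T - s n := div_le_self (sub_nonneg.2 (hsT n).le) hc21.le
      linarith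
    -- every period is null, by induction
    have hnull : ∀ n, volume ({τ | k₀ τ < sInf {κ : ℝ | (∀ (v : EuclideanSpace ℝ (Fin 3) → EuclideanSpace ℝ (Fin 3)) (M B : ℝ), ContDiff ℝ (⊤ : ℕ∞) v → Literature.Analysis.FluidPDE.VectorCalculus.IsDivFree v → (∀ x, ‖v x‖ ≤ M) → (∀ x, ‖fderiv ℝ v x‖ ≤ B) → (∫⁻ x, ‖iteratedFDeriv ℝ 0 v x‖ₑ ^ 2 < ⊤) → (∫⁻ x, ‖iteratedFDeriv ℝ 1 v x‖ₑ ^ 2 < ⊤) → (∫⁻ x, ‖iteratedFDeriv ℝ 2 v x‖ₑ ^ 2 < ⊤) → |∫ x, ⟪Literature.Analysis.FluidPDE.curl v x, fderiv ℝ v x (Literature.Analysis.FluidPDE.curl v x)⟫_ℝ| ≤ κ * M * Real.sqrt (∫ x, ‖Literature.Analysis.FluidPDE.curl v x‖ ^ 2) * Real.sqrt (∫ x, Literature.Analysis.FluidPDE.frobeniusNormSq (fderiv ℝ (Literature.Analysis.FluidPDE.curl v) x)))}} ∩ Ioc (s n) (s (n + 1))) = 0 := by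
      intro n
      induction n with
      | zero =>
        rw [Measure.restrict_apply' measurableSet_Ioc] at h0
        rw [hsucc, hs0]
        simpa using h0
      | succ m ih =>
        have := dss_nullset_transport hc hdss (fun τ => (hk₀01 τ).1) hcl hmin (hs0' m) (hmono m) (hsT _) ih
        rw [hsucc (m + 1), hsucc m] at *
        exact this
    -- the periods exhaust `(t₁, T)`
    have hcover : {τ | k₀ τ < sInf {κ : ℝ | (∀ (v : EuclideanSpace ℝ (Fin 3) → EuclideanSpace ℝ (Fin 3)) (M B : ℝ), ContDiff ℝ (⊤ : ℕ∞) v → Literature.Analysis.FluidPDE.VectorCalculus.IsDivFree v → (∀ x, ‖v x‖ ≤ M) → (∀ x, ‖fderiv ℝ v x‖ ≤ B) → (∫⁻ x, ‖iteratedFDeriv ℝ 0 v x‖ₑ ^ 2 < ⊤) → (∫⁻ x, ‖iteratedFDeriv ℝ 1 v x‖ₑ ^ 2 < ⊤) → (∫⁻ x, ‖iteratedFDeriv ℝ 2 v x‖ₑ ^ 2 < ⊤) → |∫ x, ⟪Literature.Analysis.FluidPDE.curl v x, fderiv ℝ v x (Literature.Analysis.FluidPDE.curl v x)⟫_ℝ|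 ≤ κ * M * Real.sqrt (∫ x, ‖Literature.Analysis.FluidPDE.curl v x‖ ^ 2) * Real.sqrt (∫ x, Literature.Analysis.FluidPDE.frobeniusNormSq (fderiv ℝ (Literature.Analysis.FluidPDE.curl v) x)))}} ∩ Ioo t₁ T ⊆ ⋃ n, ({τ | k₀ τ < sInf {κ : ℝ | (∀ (v : EuclideanSpace ℝ (Fin 3) → EuclideanSpace ℝ (Fin 3)) (M B : ℝ), ContDiff ℝ (⊤ : ℕ∞) v → Literature.Analysis.FluidPDE.VectorCalculus.IsDivFree v → (∀ x, ‖v x‖ ≤ M) → (∀ x, ‖fderiv ℝ v x‖ ≤ B) → (∫⁻ x, ‖iteratedFDeriv ℝ 0 v x‖ₑ ^ 2 < ⊤) → (∫⁻ x, ‖iteratedFDeriv ℝ 1 v x‖ₑ ^ 2 < ⊤) → (∫⁻ x, ‖iteratedFDeriv ℝ 2 v x‖ₑ ^ 2 < ⊤) → |∫ x, ⟪Literature.Analysis.FluidPDE.curl v x, fderiv ℝ v x (Literature.Analysis.FluidPDE.curl v x)⟫_ℝ| ≤ κ * M * Real.sqrt (∫ x, ‖Literature.Analysis.FluidPDE.curl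 v x‖ ^ 2) * Real.sqrt (∫ x, Literature.Analysis.FluidPDE.frobeniusNormSq (fderiv ℝ (Literature.Analysis.FluidPDE.curl v) x)))}} ∩ Ioc (s n) (s (n + 1))) := by
      rintro τ ⟨hk, hτ1, hτ2⟩
      simp only [mem_iUnion, mem_inter_iff, mem_setOf_eq, mem_Ioc]
      -- some period end lies beyond `τ`
      have hex : ∃ n : ℕ, τ ≤ s (n + 1) := by
        have hTτ : 0 < T - τ := sub_pos.2 hτ2
        obtain ⟨n, hn⟩ := pow_unbounded_of_one_lt ((T - t₁) / (T - τ)) hc21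
        refine ⟨n, ?_⟩
        rw [hs]
        have h1 : (T - t₁) / (c ^ 2) ^ (n + 1) ≤ T - τ := by
          rw [div_le_iff₀ (pow_pos hc2 _)]
          have h2 : (T - t₁) / (T - τ) < (c ^ 2) ^ (n + 1) :=
            lt_trans hn (pow_lt_pow_right₀ hc21 (Nat.lt_succ_self n))
          rw [div_lt_iff₀ hTτ] at h2
          linarith
        linarith
      classical
      refine ⟨Nat.find hex, hk, ?_, Nat.find_spec hex⟩
      rcases Nat.eq_zero_or_pos (Nat.find hex) with hz | hpos
      · rw [hz, hs0]; exact hτ1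
      · have hm := Nat.find_min hex (Nat.sub_one_lt_of_lt hpos)
        rw [Nat.sub_one_add_one_eq_of_pos hpos] at hm
        exact lt_of_not_ge hm
    exact measure_mono_null hcover (measure_iUnion_null hnull)
  · exact Or.inr hθ

end DepletionLadder

end Summit.NavierStokesRegularity.NavierStokesRegularity.Theorems

end
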